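import Mathlib
import Summits.NavierStokesRegularity.NavierStokesRegularity.Theorems.FilamentSkeletonRssStadiumStripPropagationQuarterProof

/-!
# Route `FilamentSkeletonRss` · crux `TangentSkeletonNearStraight` (stmt-NavierStokesRegularity-28295, child of `SkeletonJ1G`) · registered line
# `child_tangent_analytic_strip` (sha16 3ad1a13e3bb9c4f5), stub `stub_stripPropagation : StripPropagation` — BY NAME, for the TWIN

The two registered child skeletons `child_tangent_analytic_strip` (28295) and `child_tangent_analytic_strip_L` (23320) posit the stub statement
`StripPropagation` LETTER FOR LETTER identically (`Theorems.AnalyticStripStadium`, p829841, one Theorems-side copy for both).  The 23320 copy of the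
stub was closed by `Theorems.StadiumStripPropagationQuarterProof.stub_stripPropagation` (p839069, registered quarter width, symmetric-tent programme);
this file records the same theorem under this twin's name so that its registered stub closes by name as well.
HONEST FRAMING: one registered stub (the strip-propagation step) of a line toward a HYPOTHETICAL filament skeleton on the NEGATIVE side of a MODEL
route; the line's heart `stub_analyticClosing : AnalyticNewtonClosing` is untouched, `TangentSkeletonNearStraight` / `SkeletonJ1G` stay OPEN, and
nothing here bears on Navier–Stokes regularity or blow-up.  `--supports stmt-NavierStokesRegularity-28295`.
-/

set_option linter.dupNamespace false

noncomputable section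

namespace Summit.NavierStokesRegularity.NavierStokesRegularity.Theorems.StadiumStripPropagationQuarterTwin

open Summit.NavierStokesRegularity.NavierStokesRegularity.Theorems.AnalyticStripStadium

/-- **The registered stub `stub_stripPropagation : StripPropagation` of line `child_tangent_analytic_strip` (stmt-28295), BY NAME** — the twin's
copy of `Theorems.StadiumStripPropagationQuarterProof.stub_stripPropagation` (registered quarter width, no retype). [folklore] -/
theorem stub_stripPropagation : StripPropagation :=
  StadiumStripPropagationQuarterProof.stub_stripPropagation

end Summit.NavierStokesRegularity.NavierStokesRegularity.Theorems.StadiumStripPropagationQuarterTwin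

end
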